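import Summits.Langlands.Langlands.Theses.OrdinaryPrimeTransport
import Summits.Langlands.Langlands.Theorems.WachComponentCensusLiftB2UnramSplitPInPrint
import HarnessLib

/-!
# F4 `_onpath` — `Langlands → OneComplexPlaceSatakeA2` (line `OneComplexPlaceSatakeA2`, crux `ReciprocityUpToIrreducibility`,
# item stmt-Langlands-14328; G4 ladder-down generation 38)

Self-contained, NO `sorry`: the family `WindowSatakeA2`, the rung, and
`theorem OneComplexPlaceSatakeA2_of_Langlands : Langlands → OneComplexPlaceSatakeA2` (indeed `∀ c, Langlands → WindowSatakeA2 c`,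
`family_of_langlands`; and `E → every cell`, `family_of_top`): the summit's clause (A) `AutomorphicToGalois 2 Rec hcpt` for the
reciprocity datum provided by its `Nonempty` conjunct gives `Corresponds Rec ι π.1 ρ`, whose first conjunct is
`SatakeFrobCompatibleAE ι π.1 ρ` up to unfolding.  The rung is ON THE PATH: a consequence of S that S's proof must pass.
-/

noncomputable section

set_option linter.dupNamespace false

open scoped MatrixGroups Matrix NumberField
open NumberField IsDedekindDomain Field Filter Polynomial
open Literature.NumberTheory.Automorphic Literature.NumberTheory.GaloisRepresentations
open Literature.NumberTheory.PAdicHodge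
open Summit.Langlands

namespace Summit.Langlands.Langlands.Cruxes.ReciprocityUpToIrreducibility.OneComplexPlaceSatakeA2

/-! ## 1. The cell body — clause (A) of `E` at SATAKE level, `n = 2`, regular `L`-algebraic `π` -/

/-- **Cell body** (`E`'s clause (A) with `IsGeometricFramed Rec ρ ∧ Corresponds Rec ι π.1 ρ` weakened to
its first, `Rec`-free conjunct `SatakeFrobCompatibleAE ι π.1 ρ` — a.e. Satake/Frobenius compatibility in the
summit's `L`-normalisation `m = 1` — and `π` restricted to `GL₂` and to REGULAR infinity type): for every
level datum, every cuspidal `π` of `GL₂(𝔸_K)` which is `L`-algebraic and regular, every `ℓ` and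
`ι : ℚ̄_ℓ ≃ ℂ`, there is a continuous `ρ : Γ_K → GL₂(ℚ̄_ℓ)` with
`char(ρ(Frob_v)) = ∏ (X - ι⁻¹(α_j⁻¹))` at almost every finite place `v` (`α` the Satake parameter). -/
def RegularSatakeA2 (K : Type) [Field K] [NumberField K] : Prop :=
  ∀ (hcpt : isCompact_glFiniteIntegralLevel 2 K) (π : CuspidalAutomorphicRepData 2 K hcpt),
    π.1.IsLAlgebraic → (∃ T : InfinityType K 2, π.1.HasInfinityType T ∧ T.IsRegular) →
      ∀ (ℓ : ℕ) [Fact ℓ.Prime] (ι : PadicAlgCl ℓ ≃+* ℂ),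
        ∃ ρ : FramedGaloisRep K (PadicAlgCl ℓ) 2, SatakeFrobCompatibleAE ι π.1 ρ

/-- **The quadratic window** (the sector convention of routes `QuadraticWindow` / `TorsionKudlaMillsonWindow`):
`K` is a quadratic extension of a totally real field `F`.  Such `K` are exactly: totally real (`c = 0`
complex places), CM (`c = [F:ℚ]`), or of MIXED signature `(2[F:ℚ] - 2c, c)` with `1 ≤ c ≤ [F:ℚ] - 1`
(e.g. `ℚ(√(1+√2)) ⊃ ℚ(√2)`, signature `(2,1)`). -/
def IsQuadraticWindow (K : Type) [Field K] [NumberField K] : Prop :=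
  ∃ (F : Type) (_ : Field F) (_ : NumberField F) (_ : Algebra F K), IsTotallyReal F ∧ Module.finrank F K = 2

/-! ## 2. The graded family (dial = number of complex places of the window field) and the rung -/

/-- **The family** `WindowSatakeA2 c`: the cell body over every window field `K ⊃ F` (`F` totally real,
`[K:F] = 2`) with AT MOST `c` COMPLEX PLACES.  `c = 0`: `K` totally real — the FLOOR (Carayol, Taylor,
Blasius–Rogawski = lang.S27 at `n = 2`, `floor_zero`); `c = 1`: THE RUNG; `c ≥ 2`: the higher cells
(`HigherWindows`); `c ≥ [F:ℚ]` contains the CM cell (lang.S27, `cmCell`). Antitone in `c` (`mono`). -/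
def WindowSatakeA2 (c : ℕ) : Prop :=
  ∀ (F K : Type) [Field F] [NumberField F] [Field K] [NumberField K] [Algebra F K],
    IsTotallyReal F → Module.finrank F K = 2 → NumberField.InfinitePlace.nrComplexPlaces K ≤ c →
      RegularSatakeA2 K

/-- **THE RUNG** `OneComplexPlaceSatakeA2 := WindowSatakeA2 1`: Galois representations (a.e. Satake level,
`L`-normalisation) for regular `L`-algebraic cuspidal `π` on `GL₂` over every quadratic-over-totally-real
field with at most ONE complex place — i.e. over totally real fields (known), imaginary quadratic fields
(known: Harris–Soudry–Taylor, Taylor, Berger–Harcos; lang.S27) and the MIXED one-complex-place windows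
`K = F(√α)`, `F ≠ ℚ` totally real, `α` negative at exactly one real place of `F` (OPEN — the content). -/
def OneComplexPlaceSatakeA2 : Prop := WindowSatakeA2 1

theorem rung_iff_family_one : OneComplexPlaceSatakeA2 ↔ WindowSatakeA2 1 := Iff.rfl

/-- The family is antitone in the dial: a larger `c` allows more fields. -/
theorem mono {c c' : ℕ} (hle : c ≤ c') (h : WindowSatakeA2 c') : WindowSatakeA2 c :=
  fun F K _ _ _ _ _ hF hdeg hc => h F K hF hdeg (hc.trans hle)

/-- Rung ⇒ floor cell. -/
theorem floor_of_rung (h : OneComplexPlaceSatakeA2) : WindowSatakeA2 0 := mono (Nat.zero_le 1) h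

/-! ## 4. ON PATH: the top `E` and the summit imply every cell (sorry-free) -/

/-- The ladder's top, a REDUCIBLE alias of the crux decl (item stmt-Langlands-14328). -/
abbrev TopCrux : Prop :=
  Summit.Langlands.Langlands.Theses.OrdinaryPrimeTransport.ReciprocityUpToIrreducibility

example : TopCrux ↔ Summit.Langlands.Langlands.Theses.OrdinaryPrimeTransport.ReciprocityUpToIrreducibility :=
  Iff.rfl

/-- `E ⟹ every cell`: clause (A) of `E` gives `Corresponds Rec ι π.1 ρ`, whose first conjunct is the a.e.
Satake/Frobenius compatibility. [folklore] -/
theorem family_of_top (c : ℕ) (hE : TopCrux) : WindowSatakeA2 c := by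
  intro F K _ _ _ _ _ _ _ _ hcpt π hL _ ℓ _ ι
  obtain ⟨Rec, hall⟩ := hE K
  obtain ⟨ρ, -, hcorr⟩ := (hall 2 two_pos hcpt).1 π hL ℓ ι
  exact ⟨ρ, hcorr.1⟩

/-- `Langlands ⟹ every cell` (via clause (A) `AutomorphicToGalois` of the summit for any reciprocity datum,
which exists by the summit's `Nonempty` conjunct). [folklore] -/
theorem family_of_langlands (c : ℕ) (hL : _root_.Langlands) : WindowSatakeA2 c := by
  intro F K _ _ _ _ _ _ _ _ hcpt π hLalg _ ℓ _ ι
  obtain ⟨⟨Rec⟩, hall⟩ := hL K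
  have hA : AutomorphicToGalois 2 Rec hcpt := (hall Rec 2 two_pos hcpt).1
  obtain ⟨ρ, -, -, hcorr, -⟩ := hA π hLalg ℓ ι
  exact ⟨ρ, hcorr.1⟩

/-- **F4 on-path lemma**: `Langlands → OneComplexPlaceSatakeA2`. [folklore] -/
@[aesop safe apply]
theorem OneComplexPlaceSatakeA2_of_Langlands (hL : _root_.Langlands) : OneComplexPlaceSatakeA2 :=
  family_of_langlands 1 hL

theorem OneComplexPlaceSatakeA2_of_top (hE : TopCrux) : OneComplexPlaceSatakeA2 :=
  family_of_top 1 hE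

#print axioms OneComplexPlaceSatakeA2_of_Langlands
#print axioms family_of_top

end Summit.Langlands.Langlands.Cruxes.ReciprocityUpToIrreducibility.OneComplexPlaceSatakeA2

end
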